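import Literature.NumberTheory.EllipticCurves.SelmerTorsionRestriction
import Literature.NumberTheory.EllipticCurves.SelmerGaloisAction
import Literature.NumberTheory.GaloisRepresentations.ContinuousH1
import Literature.NumberTheory.EllipticCurves.KummerSelmerStructure
import HarnessLib

/-!
# Route `PrintX11a`, child crux U5 = `PrintX11a.UpperNonSurjFive` (item stmt-BirchSwinnertonDyer-20614),
# line «gl1cartan5» (rev 2), stub `stub_cartanGlobal` (D-G): the COMPLEMENT LINE over the quadratic field and
# the INJECTIVITY of the descent map — PROVED

For `E = W/ℚ` elliptic, an odd prime `p` with `E[p]` irreducible, a quadratic number field `K` and a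
`Γ_K`-stable line `L ⊆ E_K[p](K̄)` (order `p`): with `σ₀` the non-trivial automorphism of `K`, `τ̃` the
action of its chosen lift on `E_K[p](K̄)` (`IsLiftOfAut.torsionMap`), the line `L' = τ̃ L` is `Γ_K`-stable
(`IsLiftOfAut.torsionMap_smul`), meets `L` trivially (otherwise `L = τ̃ L` descends through
`torsionBaseChangeEquiv` to a `Γ_ℚ`-stable line of `E[p]`, `Γ_ℚ = galRange K ∪ galRange K · c₀`,
`xor_galRange`, contradicting irreducibility), and a class `x ∈ H¹(ℚ, E[p])` whose restriction to `K` has an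
`L'`-valued cocycle `φ` vanishes: `σ₀ · res x = res x` (`conjAct_resTorsion`) is the class of the
`τ̃ L' = L`-valued cocycle `τ̃ ∘ φ ∘ (τ̃⁻¹ · τ̃)` (`map_oneCocycleClass`), so `φ − ψ = ∂m` with `ψ` `L`-valued;
splitting `m = a + b` along `E_K[p] = L ⊕ L'` shows `φ = ∂b`, so `res x = 0` and `x = 0`
(`resTorsion_injective_of_odd`).  Gross 1991, §5 (5.1) (`Sel(E/ℚ)_p ↪ Sel(E/K)_p^+`, `p` odd).

THEOREMS ONLY (no definition, no named fact, no `sorry`); BSD is not proved by any of this.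

References: [GrossLMS1991] §5 (5.1); [SerreGaloisCohomology1997] I.§2.4–2.5, I.§5.1; [Serre1972] §4.
-/

set_option linter.dupNamespace false
set_option autoImplicit false

noncomputable section

open scoped Classical NumberField

open WeierstrassCurve Field IsDedekindDomain Literature.NumberTheory.EllipticCurves
  Literature.NumberTheory.GaloisRepresentations

namespace Summit.BirchSwinnertonDyer.BirchSwinnertonDyer.Theorems.GL1Cartan

/-- A quadratic number field has a non-trivial automorphism, and it is an involution
(`#Aut(K/ℚ) = [K : ℚ] = 2`, `IsGalois.card_aut_eq_finrank`). [folklore] -/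
theorem exists_algEquiv_ne_one_mul_self (K : Type) [Field K] [NumberField K]
    (h2 : Module.finrank ℚ K = 2) : ∃ σ₀ : K ≃ₐ[ℚ] K, σ₀ ≠ 1 ∧ σ₀ * σ₀ = 1 := by
  haveI : Algebra.IsQuadraticExtension ℚ K := ⟨h2⟩
  have hcard : Nat.card (K ≃ₐ[ℚ] K) = 2 := by rw [IsGalois.card_aut_eq_finrank, h2]
  obtain ⟨σ₀, hσ₀⟩ : ∃ σ₀ : K ≃ₐ[ℚ] K, σ₀ ≠ 1 := by
    by_contra h
    push Not at h
    haveI : Subsingleton (K ≃ₐ[ℚ] K) := ⟨fun a b ↦ by rw [h a, h b]⟩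
    have h1 : Nat.card (K ≃ₐ[ℚ] K) ≤ 1 := Finite.card_le_one_iff_subsingleton.mpr inferInstance
    omega
  refine ⟨σ₀, hσ₀, ?_⟩
  have h := orderOf_dvd_natCard σ₀
  rw [hcard, orderOf_dvd_iff_pow_eq_one, pow_two] at h
  exact h

/-- **Stub D-G of line «gl1cartan5» (complement line + injectivity over the quadratic field).**  For
`E = W/ℚ` elliptic, `p` an odd prime with `E[p]` irreducible, `K` quadratic and a `Γ_K`-stable line
`L ⊆ E_K[p](K̄)`: there is a `Γ_K`-stable line `L'` with `L ⊓ L' = ⊥` such that every `x ∈ H¹(ℚ, E[p])`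
whose restriction to `K` is represented by an `L'`-valued continuous cocycle is `0` (`L' = τ̃ L` for the
lift `τ̃` of the non-trivial automorphism of `K`; `σ₀ · res x = res x` is represented by an `L`-valued
cocycle, and `E_K[p] = L ⊕ L'`; `res` is injective for odd `p`).  Gross 1991, §5 (5.1).
[cite: GrossLMS1991, §5 (5.1)] -/
theorem stub_cartanGlobal :
    ∀ (K : Type) [Field K] [NumberField K] (_h2 : Module.finrank ℚ K = 2)
      (W : WeierstrassCurve ℚ) [W.IsElliptic] (p : ℕ) [Fact p.Prime], p ≠ 2 →
      W.HasIrreducibleModPGaloisRep p →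
      ∀ L : AddSubgroup ((W.baseChange K).geomTorsion (p : ℤ)), Nat.card L = p →
        (∀ (σ : absoluteGaloisGroup K) (P : (W.baseChange K).geomTorsion (p : ℤ)), P ∈ L → σ • P ∈ L) →
        ∃ L' : AddSubgroup ((W.baseChange K).geomTorsion (p : ℤ)),
          Nat.card L' = p ∧
          (∀ (σ : absoluteGaloisGroup K) (P : (W.baseChange K).geomTorsion (p : ℤ)), P ∈ L' → σ • P ∈ L') ∧
          L ⊓ L' = ⊥ ∧
          ∀ x : galH1Torsion W (p : ℤ),
            (∃ φ : contOneCocycles (discreteTopRep (absoluteGaloisGroup K) ((W.baseChange K).geomTorsion (p : ℤ))),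
                (∀ g, φ.1 g ∈ L') ∧ oneCocycleClass _ φ = resTorsion W K (p : ℤ) x) → x = 0 := by
  intro K _ _ h2 W _ p _ hp2 hirr L hL hLstab
  have hp : p.Prime := Fact.out
  haveI : Algebra.IsQuadraticExtension ℚ K := ⟨h2⟩
  haveI : IsGalois ℚ K := inferInstance
  haveI : Algebra.IsAlgebraic ℚ K := Algebra.IsAlgebraic.of_finite ℚ K
  obtain ⟨σ₀, hσ₀, hσσ⟩ := exists_algEquiv_ne_one_mul_self K h2
  -- orders: `#E_K[p] = p²`, `#L = p`
  have hp0 : (p : ℤ) ≠ 0 := by exact_mod_cast hp.ne_zero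
  have hcardM : Nat.card ((W.baseChange K).geomTorsion (p : ℤ)) = p ^ 2 := by
    rw [natCard_geomTorsion (W.baseChange K) (p : ℤ) hp0, Int.natAbs_natCast]
  haveI hfinM : Finite ((W.baseChange K).geomTorsion (p : ℤ)) :=
    Nat.finite_of_card_ne_zero (by rw [hcardM]; exact pow_ne_zero 2 hp.ne_zero)
  -- the chosen lift `τ` of `σ₀` and its action `T = τ̃` on `E_K[p](K̄)`
  have hτ : IsLiftOfAut σ₀ (liftAut σ₀) := isLiftOfAut_liftAut σ₀
  set T : (W.baseChange K).geomTorsion (p : ℤ) →+ (W.baseChange K).geomTorsion (p : ℤ) :=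
    hτ.torsionMap W (p : ℤ) with hT
  -- `τ ∘ τ` lifts `σ₀² = 1`, as does the identity: `T (T P) = γ • P` for some `γ ∈ Γ_K`
  have h1r : IsLiftOfAut (σ₀ * σ₀) (RingEquiv.refl (AlgebraicClosure K)) := by
    rw [hσσ]; exact isLiftOfAut_one_refl
  set γ : absoluteGaloisGroup K := (hτ.trans hτ).divGal h1r with hγ
  have hTT : ∀ P, T (T P) = γ • P := by
    intro P
    have h1 : T (T P) = (hτ.trans hτ).torsionMap W (p : ℤ) P := by
      rw [hτ.torsionMap_trans W hτ (p : ℤ)]; rfl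
    rw [h1, (hτ.trans hτ).torsionMap_eq_comp W h1r (p : ℤ), AddMonoidHom.comp_apply]
    apply Subtype.ext
    rw [IsLiftOfAut.coe_torsionMap]
    change h1r.pointsMap W ((γ • P : (W.baseChange K).geomTorsion (p : ℤ)) : geomPoints (W.baseChange K)) =
      ((γ • P : (W.baseChange K).geomTorsion (p : ℤ)) : geomPoints (W.baseChange K))
    generalize ((γ • P : (W.baseChange K).geomTorsion (p : ℤ)) : geomPoints (W.baseChange K)) = R
    change ((W.baseChange K).baseChange (AlgebraicClosure K)).toAffine.Point at R
    rcases R with _ | ⟨x, y, h⟩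
    · rfl
    · rfl
  have hTinj : Function.Injective T := fun P Q hPQ ↦ by
    have h := congrArg T hPQ
    rw [hTT, hTT] at h
    exact MulAction.injective γ h
  -- the complement line `L' = T L`
  have hL' : Nat.card (L.map T) = p := by rw [AddSubgroup.card_map_of_injective hTinj, hL]
  haveI : Finite L := Nat.finite_of_card_ne_zero (by rw [hL]; exact hp.ne_zero)
  haveI : Finite (L.map T) := Nat.finite_of_card_ne_zero (by rw [hL']; exact hp.ne_zero)
  have hL'stab : ∀ (σ : absoluteGaloisGroup K) (P : (W.baseChange K).geomTorsion (p : ℤ)),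
      P ∈ L.map T → σ • P ∈ L.map T := by
    intro σ P hP
    obtain ⟨Q, hQ, rfl⟩ := AddSubgroup.mem_map.mp hP
    exact AddSubgroup.mem_map.mpr ⟨hτ.conjGalCMH σ • Q, hLstab _ _ hQ, hτ.torsionMap_smul W (p : ℤ) σ Q⟩
  -- `T L ≠ L`: otherwise `L` descends to a `Γ_ℚ`-stable line of `E[p]`, contradicting irreducibility
  have hne : L.map T ≠ L := by
    intro hEq
    have hgal : ∀ (σ : absoluteGaloisGroup K) (P : W.geomTorsion (p : ℤ)),
        torsionBaseChangeEquiv K W (p : ℤ) P ∈ L →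
          torsionBaseChangeEquiv K W (p : ℤ) (resGal (K := ℚ) K σ • P) ∈ L := by
      intro σ P hP
      have e : torsionBaseChangeEquiv K W (p : ℤ) (resGal (K := ℚ) K σ • P) =
          σ • torsionBaseChangeEquiv K W (p : ℤ) P := torsionBaseChangeMap_smul W K (p : ℤ) σ P
      rw [e]
      exact hLstab σ _ hP
    have hc : ∀ P : W.geomTorsion (p : ℤ), torsionBaseChangeEquiv K W (p : ℤ) P ∈ L →
        torsionBaseChangeEquiv K W (p : ℤ) (liftToAbsGal (K := ℚ) K σ₀ • P) ∈ L := by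
      intro P hP
      rw [← torsionBaseChangeEquiv_smul_liftToAbsGal W (p : ℤ) σ₀ P, ← hEq]
      exact AddSubgroup.mem_map_of_mem T hP
    let L₀ : AddSubgroup (W.geomTorsion (p : ℤ)) :=
      L.comap (torsionBaseChangeEquiv K W (p : ℤ)).toAddMonoidHom
    have hstab : ∀ σ : absoluteGaloisGroup ℚ, ∀ P ∈ L₀, σ • P ∈ L₀ := by
      intro g P hP
      change torsionBaseChangeEquiv K W (p : ℤ) (g • P) ∈ L
      change torsionBaseChangeEquiv K W (p : ℤ) P ∈ L at hP
      rcases xor_galRange K h2 hσ₀ g with ⟨hg, -⟩ | ⟨hg, -⟩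
      · obtain ⟨σ, hσ⟩ := (mem_galRange_iff K _).mp hg
        have e : g • P = resGal (K := ℚ) K σ • (liftToAbsGal (K := ℚ) K σ₀ • P) := by
          rw [hσ, ← mul_smul, inv_mul_cancel_right]
        rw [e]
        exact hgal σ _ (hc P hP)
      · obtain ⟨σ, rfl⟩ := (mem_galRange_iff K _).mp hg
        exact hgal σ P hP
    have hL₀ : Nat.card L₀ = p := by
      have e : L₀ = L.map (torsionBaseChangeEquiv K W (p : ℤ)).symm.toAddMonoidHom :=
        AddSubgroup.comap_equiv_eq_map_symm' _ L
      rw [e, AddSubgroup.card_map_of_injective (torsionBaseChangeEquiv K W (p : ℤ)).symm.injective, hL]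
    unfold WeierstrassCurve.HasIrreducibleModPGaloisRep at hirr
    rcases hirr L₀ hstab with h | h
    · rw [h, AddSubgroup.card_bot] at hL₀
      exact hp.one_lt.ne' hL₀.symm
    · rw [h, AddSubgroup.card_top, natCard_geomTorsion W (p : ℤ) hp0, Int.natAbs_natCast, pow_two] at hL₀
      exact hp.one_lt.ne' (Nat.eq_of_mul_eq_mul_left hp.pos (hL₀.trans (mul_one p).symm))
  -- `L ⊓ T L = ⊥` (two distinct subgroups of prime order)
  have hbot : L ⊓ L.map T = ⊥ := by
    have hdvd : Nat.card ↥(L ⊓ L.map T) ∣ p := by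
      have h := AddSubgroup.card_dvd_of_le (inf_le_left : L ⊓ L.map T ≤ L)
      rwa [hL] at h
    rcases (Nat.dvd_prime hp).mp hdvd with h1 | h1
    · exact AddSubgroup.eq_bot_of_card_eq _ h1
    · exfalso
      apply hne
      have hle1 : L ⊓ L.map T = L :=
        AddSubgroup.eq_of_le_of_card_ge inf_le_left (by rw [hL, h1])
      have hLle : L ≤ L.map T := inf_eq_left.mp hle1
      exact (AddSubgroup.eq_of_le_of_card_ge hLle (by rw [hL', hL])).symm
  -- `L ⊔ T L = ⊤` (order `p²`)
  have hsup : L ⊔ L.map T = ⊤ := by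
    apply AddSubgroup.eq_top_of_card_eq
    rw [hcardM]
    have hd1 : Nat.card ↥(L ⊔ L.map T) ∣ p ^ 2 := by
      have h := AddSubgroup.card_addSubgroup_dvd_card (L ⊔ L.map T)
      rwa [hcardM] at h
    have hd2 : p ∣ Nat.card ↥(L ⊔ L.map T) := by
      have h := AddSubgroup.card_dvd_of_le (le_sup_left : L ≤ L ⊔ L.map T)
      rwa [hL] at h
    obtain ⟨i, hi, hci⟩ := (Nat.dvd_prime_pow hp).mp hd1
    interval_cases i
    · rw [pow_zero] at hci
      rw [hci] at hd2
      exact absurd (Nat.dvd_one.mp hd2) hp.one_lt.ne'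
    · exfalso
      rw [pow_one] at hci
      have e : L = L ⊔ L.map T := AddSubgroup.eq_of_le_of_card_ge le_sup_left (by rw [hci, hL])
      have hle : L.map T ≤ L :=
        calc L.map T ≤ L ⊔ L.map T := le_sup_right
          _ = L := e.symm
      exact hne (AddSubgroup.eq_of_le_of_card_ge hle (by rw [hL, hL']))
    · exact hci
  refine ⟨L.map T, hL', hL'stab, hbot, ?_⟩
  -- injectivity
  rintro x ⟨φ, hφL', hφx⟩
  apply resTorsion_injective_of_odd K W σ₀ h2 hσ₀ hp hp2
  rw [map_zero, ← hφx]
  -- `σ₀ · res x = res x`, and `σ₀ · [φ] = [T ∘ φ ∘ (τ⁻¹ · τ)]`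
  have hfix : conjAct W σ₀ (p : ℤ) (oneCocycleClass _ φ) = oneCocycleClass _ φ := by
    rw [hφx]
    exact conjAct_resTorsion K W (p : ℤ) σ₀ h2 hσ₀ x
  have hconj : conjAct W σ₀ (p : ℤ) =
      resH1Hom hτ.conjGalCMH T (hτ.torsionMap_smul W (p : ℤ)) := rfl
  rw [hconj] at hfix
  change ContinuousCohomology.map hτ.conjGalCMH
      (resHomOfEquivariant hτ.conjGalCMH T (hτ.torsionMap_smul W (p : ℤ))) 1 (oneCocycleClass _ φ) = _ at hfix
  rw [map_oneCocycleClass] at hfix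
  set φ' := contOneCocycles.pullback hτ.conjGalCMH
    (resHomOfEquivariant hτ.conjGalCMH T (hτ.torsionMap_smul W (p : ℤ))) φ with hφ'
  have hφ'L : ∀ g, φ'.1 g ∈ L := by
    intro g
    change T (φ.1 (hτ.conjGalCMH g)) ∈ L
    obtain ⟨P, hP, hPeq⟩ := AddSubgroup.mem_map.mp (hφL' (hτ.conjGalCMH g))
    rw [← hPeq, hTT]
    exact hLstab γ P hP
  -- `φ - φ' = ∂m`; split `m = a + b` along `L ⊕ T L`
  have h0 : oneCocycleClass _ (φ - φ') = 0 := by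
    rw [oneCocycleClass_sub, hfix, sub_self]
  obtain ⟨m, hm⟩ := (oneCocycleClass_eq_zero_iff _ _).mp h0
  have hmtop : (m : (W.baseChange K).geomTorsion (p : ℤ)) ∈ L ⊔ L.map T := by
    rw [hsup]; exact AddSubgroup.mem_top _
  obtain ⟨a, ha, b, hb, hab⟩ := AddSubgroup.mem_sup.mp hmtop
  refine (oneCocycleClass_eq_zero_iff _ φ).mpr ⟨b, fun g ↦ ?_⟩
  change φ.1 g = g • b - b
  have hmg : φ.1 g - φ'.1 g = g • (a + b) - (a + b) := by
    rw [hab]; exact hm g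
  have key : φ.1 g - (g • b - b) = φ'.1 g + (g • a - a) := by
    rw [smul_add] at hmg
    calc φ.1 g - (g • b - b) = (φ.1 g - φ'.1 g) + φ'.1 g - (g • b - b) := by abel
      _ = (g • a + g • b - (a + b)) + φ'.1 g - (g • b - b) := by rw [hmg]
      _ = φ'.1 g + (g • a - a) := by abel
  have hl : φ.1 g - (g • b - b) ∈ L.map T := sub_mem (hφL' g) (sub_mem (hL'stab g b hb) hb)
  have hr : φ'.1 g + (g • a - a) ∈ L := add_mem (hφ'L g) (sub_mem (hLstab g a ha) ha)
  have hmem : φ.1 g - (g • b - b) ∈ L ⊓ L.map T := AddSubgroup.mem_inf.mpr ⟨key ▸ hr, hl⟩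
  rw [hbot, AddSubgroup.mem_bot] at hmem
  exact sub_eq_zero.mp hmem

end Summit.BirchSwinnertonDyer.BirchSwinnertonDyer.Theorems.GL1Cartan

end
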